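import Summits.QuantumFields.YangMills.Theorems.SwapVirialDeficitBlowUpPeriodicQuatDeficit
import Summits.QuantumFields.YangMills.Theorems.SwapVirialDeficitBlowUpPeriodicHub
import HarnessLib

/-!
# The PERIODIC massive-mode rung, brick PM-I½: the SMOOTH TWO-SCALE FAMILY — raw letters affine in `(u, us, u²s)`, the identification with the
# periodic blow-up point at `u > 0`, and the JOINT `C^∞` smoothness of the deficit `G(u, s; ξ)` in `(u, s, ξ)` (input (S) of the structure theorem)
# (free-hands support of ⟨stmt-QuantumFields-24196⟩ `SwapVirialDeficit.ToronSoftnessSharp`; LEAD memo `sfw-p2-g96-memo-24196-PM-design.md` §0–§1;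
# consumes ✓PM-0a `contDiffOn_periodicChartDeficit_param`, ✓PM-0b `contDiffOn_su2Quat_quatToSU2_comp`)

The two-scale chart of PM (parameters `(u, s) = (ρ, t/ρ²)`, K4's second blow-up ✓`scaleQ3 u u⁻¹`) makes every RAW letter of ✓`periodicBlowUpPoint` a
polynomial in the parameters.  This file records that family as a SMOOTH family on all of `ℝ²` (including `u ≤ 0`, where it is no longer a chart) —
the object whose Taylor expansion at `u = s = 0` the structure theorem `G = u⁴s²Φ` is about:
* §1 `twoScaleRaw u s x = (x₀, u·x_I, us·x_J, us·x_K)`, `hubRaw u a₀ = (a₀, u, 0, 0)`; ★ `dilate_scaleQ_eq_twoScaleRaw` (`u ≠ 0`: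
  `dilate (u²s) (scaleQ u u⁻¹ x) = twoScaleRaw u s x`), `hubAt_sq_eq_hubRaw` (`0 ≤ u`); joint smoothness `contDiff_twoScaleRaw` ∕ `contDiff_hubRaw` ∕
  `contDiff_dilateIm_joint` (via `contDiff_quat_mk`);
* §2 `twoScaleLeaders u s a₀ w'`, `twoScaleFollowers τ y`, ★ `periodicBlowUpPoint_twoScale` (`u > 0`:
  `periodicBlowUpPoint (u²s) (hubAt a₀ u², (scaleQ3 u u⁻¹ w', y)) = (twoScaleLeaders u s a₀ w', twoScaleFollowers (u²s) y)`);
* §3 `twoScaleDeficit L u s a₀ w' y := periodicChartDeficit L 0 1 (twoScaleLeaders u s a₀ w', twoScaleFollowers (u²s) y)` — the `G(u, s; ξ)` of the memo —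
  `twoScaleDeficit_nonneg`, and ★★★ `contDiffOn_twoScaleDeficit`: `G` is `C^n` JOINTLY in `p = (u, s, a₀, w', y)` on the open set `twoScaleGood L` where every raw
  letter is non-zero (in particular on `ℝ² × {x₀ᵏ ≠ 0, a₀ ≠ 0, y₀ᶠ ≠ 0}`), for every `n`.
Deliberately NOT here: the fibre identification `twoScaleFibre = {balls ∧ G ≤ (u²s)²}` (one line once ✓PM-I `twoScaleFibre` is in the tree), the Taylor
structure (PM-II).
HONEST LABEL: calculus bookkeeping (plan-level fixed-`L` rung of a DRAFT line); nothing of PM, ⟨24196⟩ or ⟨24197⟩ is proved; own crux ⟨22884⟩ OPEN (blocked-on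
⟨19935⟩); the Yang–Mills mass gap is NOT proved; no summit is proved by a line.
LEAD seat ym-line-sfw-p2 g96 (cell ym-idea-1, free hands), `--supports stmt-QuantumFields-24196`.  Six `def`s + one `abbrev`, standard axioms, 0 `sorry`.
References: [cite: Luscher1983, §2]; [cite: GonzalezarroyoAltes1988]; [folklore].
-/

set_option autoImplicit false

noncomputable section

open Quaternion Set Filter Topology
open scoped Quaternion BigOperators ContDiff
open Literature.MathematicalPhysics.QuantumLattice
open Literature.MathematicalPhysics.QuantumFieldTheory hiding SU2
open Summit.QuantumFields.YangMills.Theorems.SwapTwistDeficit.ToronLog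

namespace Summit.QuantumFields.YangMills.Theorems.SwapVirialDeficit.BlowUpRing

open Summit.QuantumFields.YangMills.Theorems.FemtoTransferGap
open Summit.QuantumFields.YangMills.Theorems.FemtoTransferGap.TT
open Summit.QuantumFields.YangMills.Theorems.SwapVirialDeficit.ZeroModeSigma (dilateIm dilateIm_apply)
open Summit.QuantumFields.YangMills.Theorems.SwapVirialDeficit.ZeroModeGroup (dilate dilate_apply scaleQ scaleQ_apply scaleQ3 scaleQ3_apply)
open Summit.QuantumFields.YangMills.Theorems.SwapVirialDeficit.BlowUp (axialLetters axialLetters_def dil3P dil3P_apply)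

variable {L : ℕ} [NeZero L]

/-! ## §1 Raw letters, affine in `(u, us, u²s)` -/

section Smooth

variable {E : Type*} [NormedAddCommGroup E] [NormedSpace ℝ E] {n : ℕ∞}

/-- A quaternion-valued map is `C^n` if its four components are (✓`Quaternion.linearIsometryEquivTuple`). [folklore] -/
theorem contDiff_quat_mk {f₀ f₁ f₂ f₃ : E → ℝ} (h₀ : ContDiff ℝ n f₀) (h₁ : ContDiff ℝ n f₁) (h₂ : ContDiff ℝ n f₂) (h₃ : ContDiff ℝ n f₃) :
    @ContDiff ℝ _ E _ _ ℍ _ _ n ((fun x => ⟨f₀ x, f₁ x, f₂ x, f₃ x⟩) : E → ℍ) := by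
  have h : ((fun x => ⟨f₀ x, f₁ x, f₂ x, f₃ x⟩) : E → ℍ) =
      Quaternion.linearIsometryEquivTuple.symm ∘ fun x => (WithLp.toLp 2 ![f₀ x, f₁ x, f₂ x, f₃ x] : EuclideanSpace ℝ (Fin 4)) := by
    funext x
    rfl
  rw [h]
  refine Quaternion.linearIsometryEquivTuple.symm.contDiff.comp ?_
  rw [contDiff_euclidean]
  intro i
  fin_cases i
  · simpa using h₀
  · simpa using h₁
  · simpa using h₂
  · simpa using h₃

end Smooth

/-- **The raw two-scale leader letter** `(x₀, u·x_I, us·x_J, us·x_K)` — affine in the monomials `u`, `us`. [folklore] -/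
def twoScaleRaw (u s : ℝ) (x : ℍ) : ℍ := ⟨x.re, u * x.imI, u * s * x.imJ, u * s * x.imK⟩

/-- **The raw two-scale hub letter** `(a₀, u, 0, 0)` (`= hubAt a₀ u²` for `u ≥ 0`). [folklore] -/
def hubRaw (u a₀ : ℝ) : ℍ := ⟨a₀, u, 0, 0⟩

/-- ★ For `u ≠ 0`: K4's second blow-up followed by the transverse dilation at scale `t = u²s` IS the raw two-scale letter,
`dilate (u²s) (scaleQ u u⁻¹ x) = twoScaleRaw u s x`. [folklore] -/
theorem dilate_scaleQ_eq_twoScaleRaw {u : ℝ} (hu : u ≠ 0) (s : ℝ) (x : ℍ) : dilate (u ^ 2 * s) (scaleQ u u⁻¹ x) = twoScaleRaw u s x := by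
  rw [scaleQ_apply, dilate_apply, twoScaleRaw]
  congr 1 <;> field_simp

/-- `hubAt a₀ u² = hubRaw u a₀` for `0 ≤ u`. [folklore] -/
theorem hubAt_sq_eq_hubRaw {u : ℝ} (hu : 0 ≤ u) (a₀ : ℝ) : hubAt a₀ (u ^ 2) = hubRaw u a₀ := by
  rw [hubAt, hubRaw, Real.sqrt_sq hu]

/-- The components of the raw letters. [folklore] -/
theorem twoScaleRaw_re (u s : ℝ) (x : ℍ) : (twoScaleRaw u s x).re = x.re := rfl

/-- At `u = 0` the raw leader letter is real. [folklore] -/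
theorem twoScaleRaw_zero_left (s : ℝ) (x : ℍ) : twoScaleRaw 0 s x = (x.re : ℍ) := by
  rw [twoScaleRaw]; ext <;> simp

/-- At `s = 0` the raw leader letter lies in the `(1, i)`-plane (a torus direction). [folklore] -/
theorem twoScaleRaw_zero_right (u : ℝ) (x : ℍ) : twoScaleRaw u 0 x = ⟨x.re, u * x.imI, 0, 0⟩ := by
  rw [twoScaleRaw]; ext <;> simp

/-- A raw letter with non-zero real part never vanishes. [folklore] -/
theorem twoScaleRaw_ne_zero {x : ℍ} (hx : x.re ≠ 0) (u s : ℝ) : twoScaleRaw u s x ≠ 0 := by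
  intro h
  have := congrArg (fun q : ℍ => q.re) h
  simp only [twoScaleRaw_re] at this
  exact hx (by simpa using this)

/-- The hub letter with `a₀ ≠ 0` never vanishes. [folklore] -/
theorem hubRaw_ne_zero {a₀ : ℝ} (ha : a₀ ≠ 0) (u : ℝ) : hubRaw u a₀ ≠ 0 := by
  intro h
  have := congrArg (fun q : ℍ => q.re) h
  exact ha (by simpa [hubRaw] using this)

/-- A dilated follower with non-zero real part never vanishes. [folklore] -/
theorem dilateIm_ne_zero_of_re_ne {y : ℍ} (hy : y.re ≠ 0) (τ : ℝ) : dilateIm τ y ≠ 0 := by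
  intro h
  have := congrArg (fun q : ℍ => q.re) h
  rw [dilateIm_apply] at this
  exact hy (by simpa using this)

section Joint

variable {E : Type*} [NormedAddCommGroup E] [NormedSpace ℝ E] {n : ℕ∞}

/-- ★ `twoScaleRaw` is jointly `C^n` in `(u, s, x)` along any `C^n` data. [folklore] -/
theorem contDiff_twoScaleRaw {u s : E → ℝ} {x : E → ℍ} (hu : ContDiff ℝ n u) (hs : ContDiff ℝ n s) (hx : ContDiff ℝ n x) :
    ContDiff ℝ n fun p => twoScaleRaw (u p) (s p) (x p) := by
  unfold twoScaleRaw
  have h0 : ContDiff ℝ n fun p => (x p).re := Literature.Analysis.FluidPDE.Tao2016.contDiff_quat_re.comp hx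
  have h1 : ContDiff ℝ n fun p => (x p).imI := Literature.Analysis.FluidPDE.Tao2016.contDiff_quat_imI.comp hx
  have h2 : ContDiff ℝ n fun p => (x p).imJ := Literature.Analysis.FluidPDE.Tao2016.contDiff_quat_imJ.comp hx
  have h3 : ContDiff ℝ n fun p => (x p).imK := Literature.Analysis.FluidPDE.Tao2016.contDiff_quat_imK.comp hx
  exact contDiff_quat_mk h0 (hu.mul h1) ((hu.mul hs).mul h2) ((hu.mul hs).mul h3)

/-- ★ `hubRaw` is jointly `C^n` in `(u, a₀)`. [folklore] -/
theorem contDiff_hubRaw {u a : E → ℝ} (hu : ContDiff ℝ n u) (ha : ContDiff ℝ n a) : ContDiff ℝ n fun p => hubRaw (u p) (a p) := by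
  unfold hubRaw
  exact contDiff_quat_mk ha hu contDiff_const contDiff_const

/-- ★ `dilateIm` is jointly `C^n` in `(τ, y)`. [folklore] -/
theorem contDiff_dilateIm_joint {τ : E → ℝ} {y : E → ℍ} (hτ : ContDiff ℝ n τ) (hy : ContDiff ℝ n y) :
    ContDiff ℝ n fun p => dilateIm (τ p) (y p) := by
  have e : (fun p => dilateIm (τ p) (y p)) = fun p => (⟨(y p).re, τ p * (y p).imI, τ p * (y p).imJ, τ p * (y p).imK⟩ : ℍ) := by
    funext p; rw [dilateIm_apply]
  rw [e]
  have h0 : ContDiff ℝ n fun p => (y p).re := Literature.Analysis.FluidPDE.Tao2016.contDiff_quat_re.comp hy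
  have h1 : ContDiff ℝ n fun p => (y p).imI := Literature.Analysis.FluidPDE.Tao2016.contDiff_quat_imI.comp hy
  have h2 : ContDiff ℝ n fun p => (y p).imJ := Literature.Analysis.FluidPDE.Tao2016.contDiff_quat_imJ.comp hy
  have h3 : ContDiff ℝ n fun p => (y p).imK := Literature.Analysis.FluidPDE.Tao2016.contDiff_quat_imK.comp hy
  exact contDiff_quat_mk h0 (hτ.mul h1) (hτ.mul h2) (hτ.mul h3)

end Joint

/-! ## §2 The smooth two-scale family of leaders and followers -/

/-- **The two-scale leaders** in ✓`axialLetters` order `(x, z, y, hub)`: `Q(twoScaleRaw u s ·)` of the three non-hub letters of `w' = ((x, y), z)` and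
`Q(hubRaw u a₀)`. [folklore] -/
def twoScaleLeaders (u s a₀ : ℝ) (w' : (ℍ × ℍ) × ℍ) : Fin 4 → SU2 :=
  ![quatToSU2 (twoScaleRaw u s w'.1.1), quatToSU2 (twoScaleRaw u s w'.2), quatToSU2 (twoScaleRaw u s w'.1.2), quatToSU2 (hubRaw u a₀)]

variable (L) in
/-- **The two-scale followers** at follower scale `τ` (`= u²s`): `U_i = Q(dilateIm τ (y i))` (✓`periodicBlowUpPoint`'s followers verbatim). [folklore] -/
def twoScaleFollowers (τ : ℝ) (y : Fol L → ℍ) : Fol L → SU2 := fun i => quatToSU2 (dilateIm τ (y i))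

/-- The leaders, entry by entry. [folklore] -/
theorem twoScaleLeaders_apply (u s a₀ : ℝ) (w' : (ℍ × ℍ) × ℍ) :
    twoScaleLeaders u s a₀ w' 0 = quatToSU2 (twoScaleRaw u s w'.1.1) ∧ twoScaleLeaders u s a₀ w' 1 = quatToSU2 (twoScaleRaw u s w'.2) ∧
      twoScaleLeaders u s a₀ w' 2 = quatToSU2 (twoScaleRaw u s w'.1.2) ∧ twoScaleLeaders u s a₀ w' 3 = quatToSU2 (hubRaw u a₀) := by
  simp [twoScaleLeaders]

omit [NeZero L] in
/-- ★ **For `u > 0` the two-scale family IS the periodic blow-up point through K4's second blow-up**: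
`periodicBlowUpPoint (u²s) (hubAt a₀ u², (scaleQ3 u u⁻¹ w', y)) = (twoScaleLeaders u s a₀ w', twoScaleFollowers (u²s) y)`. [cite: GonzalezarroyoAltes1988] -/
theorem periodicBlowUpPoint_twoScale {u : ℝ} (hu : 0 < u) (s a₀ : ℝ) (w' : (ℍ × ℍ) × ℍ) (y : Fol L → ℍ) :
    periodicBlowUpPoint (L := L) (u ^ 2 * s) (hubAt a₀ (u ^ 2), (scaleQ3 u u⁻¹ w', y)) =
      (twoScaleLeaders u s a₀ w', twoScaleFollowers L (u ^ 2 * s) y) := by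
  have hu0 : u ≠ 0 := hu.ne'
  refine Prod.ext ?_ ?_
  · -- leaders
    show axialLetters (hubAt a₀ (u ^ 2), dil3P (u ^ 2 * s) (scaleQ3 u u⁻¹ w')) = twoScaleLeaders u s a₀ w'
    rw [axialLetters_def, dil3P_apply, scaleQ3_apply, axisPoint_hubAt, hubAt_sq_eq_hubRaw hu.le]
    simp only [dilate_scaleQ_eq_twoScaleRaw hu0]
    rfl
  · rfl

/-! ## §3 The two-scale deficit `G(u, s; ξ)` and its joint smoothness -/

variable (L) in
/-- ★ **THE TWO-SCALE DEFICIT** `G(u, s; a₀, w', y) := periodicChartDeficit L 0 1 (twoScaleLeaders u s a₀ w', twoScaleFollowers (u²s) y)` — for `u > 0`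
the periodic deficit along the blow-up in the two-scale chart; a smooth function of `(u, s, a₀, w', y)` on all of `ℝ² × Good`. [cite: Luscher1983, §2] -/
def twoScaleDeficit (u s a₀ : ℝ) (w' : (ℍ × ℍ) × ℍ) (y : Fol L → ℍ) : ℝ :=
  periodicChartDeficit L (fun _ => false) (fun _ => 1) (twoScaleLeaders u s a₀ w', twoScaleFollowers L (u ^ 2 * s) y)

/-- `0 ≤ G`. [cite: Luscher1983, §2] -/
theorem twoScaleDeficit_nonneg (u s a₀ : ℝ) (w' : (ℍ × ℍ) × ℍ) (y : Fol L → ℍ) : 0 ≤ twoScaleDeficit L u s a₀ w' y :=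
  periodicChartDeficit_nonneg _ _ _

/-- The parameter space of the two-scale family: `p = (u, s, a₀, w', y)`. [folklore] -/
abbrev TwoScaleParam (L : ℕ) [NeZero L] : Type := ℝ × ℝ × ℝ × ((ℍ × ℍ) × ℍ) × (Fol L → ℍ)

variable (L) in
/-- **The good set**: every raw letter of the family is non-zero (so `Q` is smooth there).  It contains `ℝ² × {x₀ᵏ ≠ 0, a₀ ≠ 0, y₀ᶠ ≠ 0}`
(`twoScaleRaw_ne_zero`, `hubRaw_ne_zero`, `dilateIm_ne_zero_of_re_ne`). [folklore] -/
def twoScaleGood : Set (TwoScaleParam L) :=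
  {p | twoScaleRaw p.1 p.2.1 p.2.2.2.1.1.1 ≠ 0 ∧ twoScaleRaw p.1 p.2.1 p.2.2.2.1.2 ≠ 0 ∧ twoScaleRaw p.1 p.2.1 p.2.2.2.1.1.2 ≠ 0 ∧
    hubRaw p.1 p.2.2.1 ≠ 0 ∧ ∀ i : Fol L, dilateIm (p.1 ^ 2 * p.2.1) (p.2.2.2.2 i) ≠ 0}

/-- ★ Points with non-degenerate real parts are good for EVERY `(u, s)`. [folklore] -/
theorem mem_twoScaleGood_of_re_ne {u s a₀ : ℝ} {w' : (ℍ × ℍ) × ℍ} {y : Fol L → ℍ} (hx : w'.1.1.re ≠ 0) (hy' : w'.1.2.re ≠ 0) (hz : w'.2.re ≠ 0)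
    (ha : a₀ ≠ 0) (hf : ∀ i, (y i).re ≠ 0) : ((u, s, a₀, w', y) : TwoScaleParam L) ∈ twoScaleGood L :=
  ⟨twoScaleRaw_ne_zero hx u s, twoScaleRaw_ne_zero hz u s, twoScaleRaw_ne_zero hy' u s, hubRaw_ne_zero ha u,
    fun i => dilateIm_ne_zero_of_re_ne (hf i) _⟩

section Param

variable {n : ℕ∞}

/-- The coordinate projection `u` of `TwoScaleParam` is smooth. [folklore] -/
theorem TwoScaleParam.cd_u : ContDiff ℝ n fun p : TwoScaleParam L => p.1 := contDiff_fst
/-- The coordinate projection `s` of `TwoScaleParam` is smooth. [folklore] -/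
theorem TwoScaleParam.cd_s : ContDiff ℝ n fun p : TwoScaleParam L => p.2.1 := contDiff_fst.comp contDiff_snd
/-- The coordinate projection `a₀` of `TwoScaleParam` is smooth. [folklore] -/
theorem TwoScaleParam.cd_a : ContDiff ℝ n fun p : TwoScaleParam L => p.2.2.1 := contDiff_fst.comp (contDiff_snd.comp contDiff_snd)
/-- The coordinate projection `w'` of `TwoScaleParam` is smooth. [folklore] -/
theorem TwoScaleParam.cd_w : ContDiff ℝ n fun p : TwoScaleParam L => p.2.2.2.1 := contDiff_fst.comp (contDiff_snd.comp (contDiff_snd.comp contDiff_snd))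
/-- The coordinate projection `y` of `TwoScaleParam` is smooth. [folklore] -/
theorem TwoScaleParam.cd_y : ContDiff ℝ n fun p : TwoScaleParam L => p.2.2.2.2 := contDiff_snd.comp (contDiff_snd.comp (contDiff_snd.comp contDiff_snd))

/-- The leader letters of the family are `C^n` on the good set. [folklore] -/
theorem contDiffOn_su2Quat_twoScaleLeaders (μ : Fin 4) :
    ContDiffOn ℝ n (fun p : TwoScaleParam L => su2Quat (twoScaleLeaders p.1 p.2.1 p.2.2.1 p.2.2.2.1 μ)) (twoScaleGood L) := by
  have hx : ContDiff ℝ n fun p : TwoScaleParam L => twoScaleRaw p.1 p.2.1 p.2.2.2.1.1.1 :=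
    contDiff_twoScaleRaw TwoScaleParam.cd_u TwoScaleParam.cd_s (contDiff_fst.comp (contDiff_fst.comp TwoScaleParam.cd_w))
  have hy : ContDiff ℝ n fun p : TwoScaleParam L => twoScaleRaw p.1 p.2.1 p.2.2.2.1.1.2 :=
    contDiff_twoScaleRaw TwoScaleParam.cd_u TwoScaleParam.cd_s (contDiff_snd.comp (contDiff_fst.comp TwoScaleParam.cd_w))
  have hz : ContDiff ℝ n fun p : TwoScaleParam L => twoScaleRaw p.1 p.2.1 p.2.2.2.1.2 :=
    contDiff_twoScaleRaw TwoScaleParam.cd_u TwoScaleParam.cd_s (contDiff_snd.comp TwoScaleParam.cd_w)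
  have hh : ContDiff ℝ n fun p : TwoScaleParam L => hubRaw p.1 p.2.2.1 := contDiff_hubRaw TwoScaleParam.cd_u TwoScaleParam.cd_a
  fin_cases μ
  · simp only [twoScaleLeaders, Fin.zero_eta, Matrix.cons_val_zero]
    exact contDiffOn_su2Quat_quatToSU2_comp hx.contDiffOn fun p hp => hp.1
  · simp only [twoScaleLeaders, Fin.mk_one, Matrix.cons_val_one, Matrix.cons_val_zero]
    exact contDiffOn_su2Quat_quatToSU2_comp hz.contDiffOn fun p hp => hp.2.1
  · simp only [twoScaleLeaders, Fin.reduceFinMk, Matrix.cons_val]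
    exact contDiffOn_su2Quat_quatToSU2_comp hy.contDiffOn fun p hp => hp.2.2.1
  · simp only [twoScaleLeaders, Fin.reduceFinMk, Matrix.cons_val]
    exact contDiffOn_su2Quat_quatToSU2_comp hh.contDiffOn fun p hp => hp.2.2.2.1

/-- The follower letters of the family are `C^n` on the good set. [folklore] -/
theorem contDiffOn_su2Quat_twoScaleFollowers (i : Fol L) :
    ContDiffOn ℝ n (fun p : TwoScaleParam L => su2Quat (twoScaleFollowers L (p.1 ^ 2 * p.2.1) p.2.2.2.2 i)) (twoScaleGood L) := by
  have hτ : ContDiff ℝ n fun p : TwoScaleParam L => p.1 ^ 2 * p.2.1 := (TwoScaleParam.cd_u.pow 2).mul TwoScaleParam.cd_s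
  have hyi : ContDiff ℝ n fun p : TwoScaleParam L => p.2.2.2.2 i := (contDiff_apply ℝ ℍ i).comp TwoScaleParam.cd_y
  have h := contDiff_dilateIm_joint hτ hyi
  unfold twoScaleFollowers
  exact contDiffOn_su2Quat_quatToSU2_comp h.contDiffOn fun p hp => hp.2.2.2.2 i

/-- ★★★ **THE TWO-SCALE DEFICIT IS JOINTLY `C^n` IN `(u, s, a₀, w', y)` ON THE GOOD SET**, for every `n` — input (S) of the PM structure theorem
(✓PM-0a `contDiffOn_periodicChartDeficit_param`). [cite: Luscher1983, §2] -/
theorem contDiffOn_twoScaleDeficit :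
    ContDiffOn ℝ n (fun p : TwoScaleParam L => twoScaleDeficit L p.1 p.2.1 p.2.2.1 p.2.2.2.1 p.2.2.2.2) (twoScaleGood L) := by
  unfold twoScaleDeficit
  exact contDiffOn_periodicChartDeficit_param (L := L) (fun _ => false) (fun _ => 1)
    (C := fun p : TwoScaleParam L => twoScaleLeaders p.1 p.2.1 p.2.2.1 p.2.2.2.1)
    (U := fun p : TwoScaleParam L => twoScaleFollowers L (p.1 ^ 2 * p.2.1) p.2.2.2.2)
    contDiffOn_su2Quat_twoScaleLeaders contDiffOn_su2Quat_twoScaleFollowers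

/-- ★★ In particular, at a point with non-degenerate real parts, `(u, s) ↦ G(u, s; ξ)` is `C^n` on all of `ℝ²` (as a function of the pair). [folklore] -/
theorem contDiff_twoScaleDeficit_pair {a₀ : ℝ} {w' : (ℍ × ℍ) × ℍ} {y : Fol L → ℍ} (hx : w'.1.1.re ≠ 0) (hy' : w'.1.2.re ≠ 0) (hz : w'.2.re ≠ 0)
    (ha : a₀ ≠ 0) (hf : ∀ i, (y i).re ≠ 0) :
    ContDiff ℝ n fun q : ℝ × ℝ => twoScaleDeficit L q.1 q.2 a₀ w' y := by
  have hι : ContDiff ℝ n fun q : ℝ × ℝ => ((q.1, q.2, a₀, w', y) : TwoScaleParam L) :=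
    contDiff_fst.prodMk (contDiff_snd.prodMk contDiff_const)
  have hmaps : ∀ q : ℝ × ℝ, ((q.1, q.2, a₀, w', y) : TwoScaleParam L) ∈ twoScaleGood L :=
    fun q => mem_twoScaleGood_of_re_ne hx hy' hz ha hf
  have h := (contDiffOn_twoScaleDeficit (L := L) (n := n)).comp (hι.contDiffOn (s := Set.univ)) (fun x _ => hmaps x)
  rw [← contDiffOn_univ]
  exact h

end Param

end Summit.QuantumFields.YangMills.Theorems.SwapVirialDeficit.BlowUpRing

end
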